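import Summits.KontsevichZagierPeriods.KontsevichZagierPeriods.Theorems.RootDecompRelativeModAbsoluteAngleFoldP1

/-! # `RootDecompRelativeModAbsoluteAngleFoldP2` — part 2/9 of the mechanical ≤400-line split of `af_src.lean` (sha256 2a2742458ba4dd14…)
Source: decomp-kz lens-3 g14 AngleFold.lean @5fd37862 (lint-fixed copy @30e24be4 by writer g8 per critic g6-12): ANGLE ADDITION IN FAMILIES — angleCellwiseFoldAt_one : AngleCellwiseFoldAt 1 PROVED (critic CLEARED g6-12 l.1335); --supports stmt-KontsevichZagierPeriods-30572.
Split by census-1 g10 `gen/splitlean.py`: scopes re-opened with their `open`/`variable`/`set_option` context; mathematics and declaration order unchanged. -/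

noncomputable section
open Set MeasureTheory
open Literature.NumberTheory.Transcendental Literature.ModelTheory.ExponentialFields
namespace Summit.KontsevichZagierPeriods.RootDecompRelativeModAbsolute.Rung30571.RegularisedLogLayer.CylLog.Leaf.G13
namespace AngleFold
namespace Base
variable {m : ℕ} (B : Base m)

/-- Normal-form invariant: `θ = k·(π/2) + ε·arctan a` and `x = (2k)•A 1 + ε•A a` simultaneously (`ε = ±1`, `a ≥ 0`
admissible). -/
def Inv (θ : ℝ) (x : Q) : Prop :=
  ∃ (k ε : ℤ) (a : ℝ), (ε = 1 ∨ ε = -1) ∧ 0 ≤ a ∧ SaConst B.T a ∧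
    θ = k * (Real.pi / 2) + ε * Real.arctan a ∧ x = (2 * k) • B.A 1 + ε • B.A a

/-- Auxiliary step `inv_congr`: inv congr. [bookkeeping] -/
theorem inv_congr {θ θ' : ℝ} {x x' : Q} (h : B.Inv θ x) (hθ : θ = θ') (hx : x = x') : B.Inv θ' x' := by
  subst hθ hx; exact h

/-- Auxiliary step `inv_zero`: inv zero. [bookkeeping] -/
theorem inv_zero : B.Inv 0 0 :=
  ⟨0, 1, 0, Or.inl rfl, le_rfl, saConst_zero B.hT, by simp, by simp [B.A_zero]⟩

/-- One signed step of the accumulator. -/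
theorem inv_step {θ : ℝ} {x : Q} (h : B.Inv θ x) {d : ℝ} (hd : 0 ≤ d) (hds : SaConst B.T d) {δ : ℤ}
    (hδ : δ = 1 ∨ δ = -1) : B.Inv (θ + δ * Real.arctan d) (x + δ • B.A d) := by
  obtain ⟨k, ε, a, hε, ha, has, hθ, hx⟩ := h
  have h1s := saConst_one B.hT
  -- either `δ = ε` (addition) or `δ = -ε` (subtraction)
  have hcase : δ = ε ∨ δ = -ε := by
    rcases hε with rfl | rfl <;> rcases hδ with rfl | rfl <;> simp
  rcases hcase with rfl | rfl
  · -- addition `arctan a + arctan d`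
    rcases lt_trichotomy (a * d) 1 with hlt | heq | hgt
    · refine ⟨k, δ, (a + d) / (1 - a * d), hε, div_nonneg (add_nonneg ha hd) (by linarith),
        (has.add hds).div (h1s.sub (has.mul hds)) (by linarith), ?_, ?_⟩
      · rw [hθ, ← Real.arctan_add hlt]; ring
      · rw [hx, ← B.A_add_of_lt ha hd has hds hlt, smul_add]; abel
    · refine ⟨k + δ, δ, 0, hε, le_rfl, saConst_zero B.hT, ?_, ?_⟩
      · rw [hθ, Real.arctan_zero, add_assoc, ← mul_add, arctan_add_of_prod_eq ha heq]; push_cast; ring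
      · rw [hx, B.A_zero, smul_zero, add_zero, add_assoc, ← smul_add, B.A_add_of_eq ha has heq, smul_smul,
          ← add_smul]
        congr 1; ring
    · have he0 : 0 ≤ (a + d) / (a * d - 1) := div_nonneg (add_nonneg ha hd) (by linarith)
      have hes : SaConst B.T ((a + d) / (a * d - 1)) := (has.add hds).div ((has.mul hds).sub h1s) (by linarith)
      refine ⟨k + 2 * δ, -δ, (a + d) / (a * d - 1), by rcases hε with rfl | rfl <;> simp, he0, hes, ?_, ?_⟩
      · rw [hθ, add_assoc, ← mul_add, arctan_add_of_prod_gt ha hgt]; push_cast; ring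
      · rw [hx, add_assoc, ← smul_add, B.A_add_of_gt ha hd has hds hgt, smul_sub, smul_smul, neg_smul, mul_add,
          add_smul]
        rw [show (2 * (2 * δ)) = δ * 4 by ring]
        rw [← smul_smul]
        abel
  · -- subtraction `arctan a - arctan d`
    rcases le_or_gt d a with hda | had
    · refine ⟨k, ε, (a - d) / (1 + a * d), hε, div_nonneg (by linarith) (by positivity),
        (has.sub hds).div (h1s.add (has.mul hds)) (by positivity), ?_, ?_⟩
      · rw [hθ, ← arctan_sub_of_le hd hda]; push_cast; ring
      · rw [hx, ← B.A_sub_of_le hd hda has hds, smul_sub, neg_smul]; abel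
    · refine ⟨k, -ε, (d - a) / (1 + d * a), by rcases hε with rfl | rfl <;> simp,
        div_nonneg (by linarith) (by positivity), (hds.sub has).div (h1s.add (hds.mul has)) (by positivity), ?_, ?_⟩
      · rw [hθ, ← arctan_sub_of_le ha had.le]; push_cast; ring
      · rw [hx, ← B.A_sub_of_le ha had.le hds has, smul_sub, neg_smul, neg_smul]; abel

/-- Integer multiples. -/
theorem inv_zsmul {θ : ℝ} {x : Q} (h : B.Inv θ x) {d : ℝ} (hd : 0 ≤ d) (hds : SaConst B.T d) (g : ℤ) :
    B.Inv (θ + g * Real.arctan d) (x + g • B.A d) := by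
  induction g using Int.induction_on with
  | zero => exact B.inv_congr h (by simp) (by simp)
  | succ i ih =>
    exact B.inv_congr (B.inv_step ih hd hds (δ := 1) (Or.inl rfl)) (by push_cast; ring) (by rw [add_smul, one_smul, add_assoc])
  | pred i ih =>
    exact B.inv_congr (B.inv_step ih hd hds (δ := -1) (Or.inr rfl)) (by push_cast; ring)
      (by rw [sub_smul, one_smul, neg_one_zsmul, sub_eq_add_neg, add_assoc])

/-- Finite sums. -/
theorem inv_sum {ι : Type*} (s : Finset ι) (g : ι → ℤ) (d : ι → ℝ) (hd : ∀ i ∈ s, 0 ≤ d i)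
    (hds : ∀ i ∈ s, SaConst B.T (d i)) :
    B.Inv (∑ i ∈ s, (g i : ℝ) * Real.arctan (d i)) (∑ i ∈ s, g i • B.A (d i)) := by
  classical
  induction s using Finset.induction_on with
  | empty => simpa using B.inv_zero
  | insert i s hi ih =>
    rw [Finset.sum_insert hi, Finset.sum_insert hi, add_comm ((g i : ℝ) * _), add_comm (g i • _)]
    exact B.inv_zsmul (ih (fun j hj => hd j (Finset.mem_insert_of_mem hj))
      (fun j hj => hds j (Finset.mem_insert_of_mem hj))) (hd i (Finset.mem_insert_self i s))
      (hds i (Finset.mem_insert_self i s)) (g i)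

/-- Terminal step: an exact normal form is trivial. -/
theorem inv_terminal {x : Q} (h : B.Inv 0 x) : x = 0 := by
  obtain ⟨k, ε, a, hε, ha, has, hθ, hx⟩ := h
  have h0 : 0 ≤ Real.arctan a := Real.arctan_nonneg.2 ha
  have hlt : Real.arctan a < Real.pi / 2 := Real.arctan_lt_pi_div_two a
  have hpi : 0 < Real.pi := Real.pi_pos
  have hk : k = 0 := by
    rcases hε with rfl | rfl
    · push_cast at hθ
      have h1 : (-1 : ℝ) < k := by
        by_contra hc; rw [not_lt] at hc; nlinarith
      have h2 : (k : ℝ) ≤ 0 := by nlinarith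
      have h1' : (-1 : ℤ) < k := by exact_mod_cast h1
      have h2' : k ≤ 0 := by exact_mod_cast h2
      omega
    · push_cast at hθ
      have h1 : (0 : ℝ) ≤ k := by nlinarith
      have h2 : (k : ℝ) < 1 := by
        by_contra hc; rw [not_lt] at hc; nlinarith
      have h1' : (0 : ℤ) ≤ k := by exact_mod_cast h1
      have h2' : k < 1 := by exact_mod_cast h2
      omega
  subst hk
  have ha0 : Real.arctan a = 0 := by
    rcases hε with rfl | rfl <;> · push_cast at hθ; linarith
  rw [Real.arctan_eq_zero_iff] at ha0
  subst ha0
  rw [hx, B.A_zero]; simp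

/-- **The exact constant angle fold (CAF₀).** An exact integer relation `Σ_i g_i arctan d_i = 0` among arctangents of
admissible constants is generated by KZ moves, uniformly in the integrable coefficient `κ`:
`Σ_i g_i • [band T 0 d_i, κ/(1+t²)] = 0` modulo `KZ.relations`. -/
theorem constAngleFold_exact {ι : Type*} (s : Finset ι) (g : ι → ℤ) (d : ι → ℝ) (hd : ∀ i ∈ s, 0 ≤ d i)
    (hds : ∀ i ∈ s, SaConst B.T (d i)) (hrel : ∑ i ∈ s, (g i : ℝ) * Real.arctan (d i) = 0) :
    ∑ i ∈ s, g i • B.A (d i) = 0 :=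
  B.inv_terminal (B.inv_congr (B.inv_sum s g d hd hds) hrel rfl)

end Base

/-! ### §C1 Integer multiples and sums of coefficients. -/

namespace Base

variable {m : ℕ} (B : Base m)

/-- The base with coefficient `g·κ`. -/
def smul (g : ℤ) : Base m :=
  ⟨B.T, fun x => (g : ℝ) * B.κ x, B.hT,
    IsSemialgebraicFunOn.mul_holds ((isSemialgebraicFunOn_ratCast B.hT (g : ℚ)).congr fun _ _ => by simp) B.hκ,
    B.hκi.const_mul _⟩

/-- Auxiliary step `smul_T` (§C1): smul T. [bookkeeping] -/
@[simp] theorem smul_T (g : ℤ) : (B.smul g).T = B.T := rfl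
/-- Auxiliary step `smul_κ` (§C1): smul κ. [bookkeeping] -/
@[simp] theorem smul_κ (g : ℤ) : (B.smul g).κ = fun x => (g : ℝ) * B.κ x := rfl

/-- Auxiliary step `smul_A_nat` (§C1): smul A nat. [bookkeeping] -/
theorem smul_A_nat (k : ℕ) (d : ℝ) : (B.smul k).A d = (k : ℤ) • B.A d := by
  classical
  by_cases h : 0 ≤ d ∧ SaConst B.T d
  · obtain ⟨h0, hs⟩ := h
    rw [(B.smul k).A_eq h0 hs, B.A_eq h0 hs]
    obtain ⟨z, hzd, hzi⟩ := KZ.exists_zeroRep ((B.smul k).rep h0 hs).isSemialgebraic_domain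
    have h := KZ.of_sub_of_sub_sum_mem_relations k ((B.smul k).rep h0 hs) z (fun _ => B.rep h0 hs) hzd
      (fun _ => rfl) fun w _ => by
        simp only [hzi, Pi.zero_apply, zero_add, Finset.sum_const, Finset.card_univ, Fintype.card_fin,
          nsmul_eq_mul, Base.rep_integrand]
        show ((k : ℤ) : ℝ) * B.κ (Fin.init w) / (1 + w (Fin.last m) ^ 2) =
          (k : ℝ) * (B.κ (Fin.init w) / (1 + w (Fin.last m) ^ 2))
        push_cast; ring
    have h' := mk_eq_zero h
    rw [map_sub, map_sub, map_sum, mk_eq_zero (KZ.of_mem_relations_of_eqOn_zero z (by rw [hzi]; exact fun _ _ => rfl)),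
      sub_zero, Finset.sum_const, Finset.card_univ, Fintype.card_fin, sub_eq_zero] at h'
    rw [natCast_zsmul]
    exact h'
  · unfold A
    rw [dif_neg h, dif_neg (by simpa using h), smul_zero]

/-- Auxiliary step `smul_A` (§C1): smul A. [bookkeeping] -/
theorem smul_A (g : ℤ) (d : ℝ) : (B.smul g).A d = g • B.A d := by
  classical
  obtain ⟨k, rfl | rfl⟩ := Int.eq_nat_or_neg g
  · exact B.smul_A_nat k d
  · -- `[(-k)κ] + [kκ] = [0] = 0`
    by_cases h : 0 ≤ d ∧ SaConst B.T d
    · obtain ⟨h0, hs⟩ := h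
      have hk := B.smul_A_nat k d
      rw [(B.smul k).A_eq h0 hs] at hk
      rw [(B.smul (-(k:ℤ))).A_eq h0 hs]
      obtain ⟨z, hzd, hzi⟩ := KZ.exists_zeroRep ((B.smul k).rep h0 hs).isSemialgebraic_domain
      have h := KZ.of_sub_of_sub_sum_mem_relations 1 z ((B.smul (-(k:ℤ))).rep h0 hs) (fun _ => (B.smul k).rep h0 hs)
        (by rw [hzd, Base.rep_domain, Base.rep_domain, Base.smul_T, Base.smul_T])
        (fun _ => by rw [hzd]) fun w _ => by
          simp only [hzi, Pi.zero_apply, Finset.univ_unique, Finset.sum_singleton, Base.rep_integrand, Base.smul_κ]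
          push_cast; ring
      have h' := mk_eq_zero h
      rw [map_sub, map_sub, map_sum, mk_eq_zero (KZ.of_mem_relations_of_eqOn_zero z (by rw [hzi]; exact fun _ _ => rfl)),
        Finset.univ_unique, Finset.sum_singleton, zero_sub] at h'
      rw [sub_eq_zero, neg_eq_iff_eq_neg] at h'
      have e1 : cl ((B.smul (-(k:ℤ))).rep h0 hs) = - cl ((B.smul (k:ℤ)).rep h0 hs) := h'
      rw [e1, hk, neg_smul]
    · unfold A
      rw [dif_neg h, dif_neg (by simpa using h), smul_zero]

end Base

/-- **Linearity in the coefficient.** An honest representation on `band T 0 d` whose integrand is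
`(Σ_i g_i κ_i(x))/(1+t²)` with admissible `κ_i` has class `Σ_i g_i • A_{κ_i}(d)`. -/
theorem cl_eq_sum_smul_A {m r : ℕ} {T : Set (Fin m → ℝ)} (hT : IsSemialgebraic ℚ T)
    (κ : Fin r → (Fin m → ℝ) → ℝ) (hκ : ∀ i, IsSemialgebraicFunOn ℚ T (κ i)) (hκi : ∀ i, IntegrableOn (κ i) T)
    {d : ℝ} (h0 : 0 ≤ d) (hs : SaConst T d) (g : Fin r → ℤ) (V : KZ.IntegralRep (m + 1))
    (hVd : V.domain = KZlog.band T (fun _ => 0) (fun _ => d))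
    (hVi : EqOn V.integrand (fun z => (∑ i, (g i : ℝ) * κ i (Fin.init z)) / (1 + z (Fin.last m) ^ 2)) V.domain) :
    cl V = ∑ i, g i • (⟨T, κ i, hT, hκ i, hκi i⟩ : Base m).A d := by
  classical
  set B : Fin r → Base m := fun i => ⟨T, κ i, hT, hκ i, hκi i⟩ with hB
  obtain ⟨z, hzd, hzi⟩ := KZ.exists_zeroRep V.isSemialgebraic_domain
  have h := KZ.of_sub_of_sub_sum_mem_relations r V z (fun i => ((B i).smul (g i)).rep h0 (by exact hs)) hzd
    (fun i => by rw [hVd, Base.rep_domain, Base.smul_T]) fun w hw => by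
      show V.integrand w = z.integrand w + ∑ i, (((B i).smul (g i)).rep h0 (by exact hs)).integrand w
      rw [hVi hw, hzi, Pi.zero_apply, zero_add]
      simp only [Base.rep_integrand, Base.smul_κ, hB, Finset.sum_div]
  have h' := mk_eq_zero h
  rw [map_sub, map_sub, map_sum, mk_eq_zero (KZ.of_mem_relations_of_eqOn_zero z (by rw [hzi]; exact fun _ _ => rfl)),
    sub_zero, sub_eq_zero] at h'
  refine (show cl V = _ from h').trans (Finset.sum_congr rfl fun i _ => ?_)
  rw [← (B i).smul_A (g i) d, ((B i).smul (g i)).A_eq h0 (by exact hs)]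
  rfl

/-! ### §C2 Integrability of the coefficient of an honest constant-argument monomial. -/

/-- Auxiliary step `integral_abs_arctanKernel` (§C2): integral abs arctan Kernel. [bookkeeping] -/
theorem integral_abs_arctanKernel (q : ℝ) {d : ℝ} (hd : 0 ≤ d) :
    ∫ t in Icc (0:ℝ) d, |q / (1 + t ^ 2)| = |q| * Real.arctan d := by
  have heq : EqOn (fun t : ℝ => |q / (1 + t ^ 2)|) (fun t => |q| * (1 + t ^ 2)⁻¹) (Icc 0 d) := fun t _ => by
    show |q / (1 + t ^ 2)| = |q| * (1 + t ^ 2)⁻¹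
    rw [abs_div, abs_of_pos (by positivity : (0:ℝ) < 1 + t ^ 2), div_eq_mul_inv]
  rw [setIntegral_congr_fun measurableSet_Icc heq, integral_Icc_eq_integral_Ioc,
    ← intervalIntegral.integral_of_le hd, intervalIntegral.integral_const_mul, integral_inv_one_add_sq,
    Real.arctan_zero, sub_zero]

/-- Honesty of `[band T 0 d, p/(1+t²)]` with a constant `d > 0` forces `p ∈ L¹(T)`. -/
theorem integrableOn_coeff_of_honest {m : ℕ} {T : Set (Fin m → ℝ)} (hT : IsSemialgebraic ℚ T)
    {p : (Fin m → ℝ) → ℝ} (hp : IsSemialgebraicFunOn ℚ T p) {d : ℝ} (hd : 0 < d) (V : KZ.IntegralRep (m + 1))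
    (hVd : V.domain = KZlog.band T (fun _ => 0) (fun _ => d))
    (hVi : EqOn V.integrand (fun z => p (Fin.init z) / (1 + z (Fin.last m) ^ 2)) V.domain) :
    IntegrableOn p T := by
  have hTm : MeasurableSet T := hT.measurableSet_holds
  have h1 := integrableOn_fibre_abs_band V hVd hTm (F := fun x t => p x / (1 + t ^ 2)) fun x hx t ht => by
    have hz : (Fin.snoc x t : Fin (m + 1) → ℝ) ∈ V.domain := by
      rw [hVd]; exact KZlog.snoc_mem_band.2 ⟨hx, ht⟩
    rw [hVi hz]; simp
  have h2 : IntegrableOn (fun x => |p x| * Real.arctan d) T :=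
    h1.congr_fun (fun x _ => integral_abs_arctanKernel (p x) hd.le) hTm
  have hne : Real.arctan d ≠ 0 := (Real.arctan_pos.2 hd).ne'
  have h3 : IntegrableOn (fun x => |p x|) T := by
    have h2' : IntegrableOn (fun x => |p x| * Real.arctan d * (Real.arctan d)⁻¹) T := h2.mul_const _
    refine IntegrableOn.congr_fun h2' (fun x _ => ?_) hTm
    show |p x| * Real.arctan d * (Real.arctan d)⁻¹ = |p x|
    rw [mul_assoc, mul_inv_cancel₀ hne, mul_one]
  have h4 : IntegrableOn (fun x => ‖p x‖) T := h3.congr_fun (fun x _ => (Real.norm_eq_abs _).symm) hTm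
  exact (integrable_norm_iff (KZ.aestronglyMeasurable_of_isSemialgebraicFunOn hp hTm)).1 h4

/-! ### §C3 Linear algebra over `ℚ`: homogenising the budget and extracting integrable coefficients. -/

/-- Rational left inverse of an independent rational family (after the tree's `cone_exists_leftInv`,
`LiouvilleUnfoldingLogPrimitiveNLStubConeDecomposition`, with an arbitrary finite coordinate type). -/
theorem exists_leftInv {ι J : Type*} [Fintype ι] [DecidableEq ι] [Fintype J] [DecidableEq J] (w : ι → J → ℚ)
    (T : Finset ι)
    (hT : ∀ μ : ι → ℚ, (∀ j, j ∉ T → μ j = 0) → (∀ i, ∑ j, μ j * w j i = 0) → ∀ j, μ j = 0) :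
    ∃ β : ι → J → ℚ, (∀ j, j ∉ T → β j = 0) ∧
      ∀ j ∈ T, ∀ j' ∈ T, ∑ i, β j i * w j' i = if j = j' then 1 else 0 := by
  classical
  let Φ : (T → ℚ) →ₗ[ℚ] (J → ℚ) := Fintype.linearCombination ℚ (fun j : T => w j)
  have hker : LinearMap.ker Φ = ⊥ := by
    rw [LinearMap.ker_eq_bot']
    intro x hx
    let μ : ι → ℚ := fun j => if h : j ∈ T then x ⟨j, h⟩ else 0
    have hμ : ∀ i, ∑ j, μ j * w j i = 0 := by
      intro i
      have h1 : (Φ x) i = 0 := by rw [hx]; rfl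
      rw [Fintype.linearCombination_apply, Finset.sum_apply] at h1
      simp only [Pi.smul_apply, smul_eq_mul] at h1
      calc ∑ j, μ j * w j i = ∑ j ∈ T, μ j * w j i :=
            (Finset.sum_subset (Finset.subset_univ T) fun j _ hj => by simp [μ, hj]).symm
        _ = ∑ j : T, μ j * w j i := (Finset.sum_coe_sort _ _).symm
        _ = ∑ j : T, x j * w j i := Finset.sum_congr rfl fun j _ => by simp [μ, j.2]
        _ = 0 := h1
    ext j
    simpa [μ, j.2] using hT μ (fun j hj => dif_neg hj) hμ j
  obtain ⟨Ψ, hΨ⟩ := Φ.exists_leftInverse_of_injective hker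
  have hΨΦ : ∀ x, Ψ (Φ x) = x := fun x => by
    rw [← LinearMap.comp_apply, hΨ, LinearMap.id_apply]
  refine ⟨fun j i => if h : j ∈ T then Ψ (Pi.single i 1) ⟨j, h⟩ else 0, fun j hj => ?_,
    fun j hj j' hj' => ?_⟩
  · ext i
    simp [hj]
  · simp only [dif_pos hj]
    have h1 : ∑ i, Ψ (Pi.single i 1) ⟨j, hj⟩ * w j' i = Ψ (w j') ⟨j, hj⟩ := by
      have hw : w j' = ∑ i, w j' i • (Pi.single i (1 : ℚ) : J → ℚ) := by
        ext i
        simp [Finset.sum_apply, Pi.single_apply]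
      conv_rhs => rw [hw, map_sum, Finset.sum_apply]
      refine Finset.sum_congr rfl fun i _ => ?_
      rw [map_smul, Pi.smul_apply, smul_eq_mul, mul_comm]
    have h2 : w j' = Φ (Pi.single ⟨j', hj'⟩ 1) := by
      simp only [Φ, Fintype.linearCombination_apply_single, one_smul]
    rw [h1, h2, hΨΦ, Pi.single_apply]
    simp only [Subtype.mk.injEq]

end AngleFold
end Summit.KontsevichZagierPeriods.RootDecompRelativeModAbsolute.Rung30571.RegularisedLogLayer.CylLog.Leaf.G13
end
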